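import Mathlib
import Summits.Ventures.PercRepro2.TypedContract
import Summits.Ventures.PercRepro2.TypedResidualBase
import Summits.Ventures.PercRepro2.TypedSupportRestrict
import Summits.Ventures.PercRepro2.TypedCaterpillarA

/-!
# The caterpillar corner on the census instances: `o` pendant at `b` (blind cell PercRepro2,
mine-2 g52, 2026-08-29; `conjectures/MINE-2.md` M2-109 (4))

`TypedCaterpillarA.lean` takes the pair `o = b` literally.  The instances of the census have `o`
and `b` as DISTINCT vertices, `o` a leaf at `b` by an edge `eob` of class `≥ 1`, `b` carrying
exactly the edges `gp = {b, x}` and `eob`.  **`caterpillarA_census_corner`** transfers the corner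
to them: night-3's leaf rule for `o` (`typedCount_pendant_o`, the factor `C(2, τ eob − 1)`), the
pinned-open `eob` contracted into `b` (`typedCount_contract_open`: the marks become `o ↦ b`), the
resulting pinned loop closed (`typedCount_pinned_loop`), the instance restricted to its support
(`Restrict.typedCount_restrict`: the loop leaves the edge type), and the caterpillar theorem on
the restricted instance.  `N₁ = N₃`, `N₂ = 2·N₃`, `N₃ = C(2, τ eob − 1) · 2 · C(2, τ ex)`.
Own work; standard axioms.
-/

namespace Summit.Ventures.PercRepro2

namespace CovForm

namespace TypedRed

open OneTyped Contract Restrict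

section Census

open Classical

variable {V : Type*} {E : Type*} [DecidableEq V] [Fintype E] [DecidableEq E] {R : Type*} [Field R]
variable (ends : E → Sym2 V) (o a₁ a₂ a₃ b u x : V)

/-- **The caterpillar corner, census form (family A)**: `a₃ —1— u —c— x —1— a₂`, `x —1— b`,
`b —(≥ 1)— o` (`o` a leaf at `b`), the root `a₁` pendant at `u`, every other edge pinned closed,
`c ∈ {1, 2}`: `N₁ = N₃`, `N₂ = 2·N₃`, `N₃ = C(2, τ eob − 1) · 2 · C(2, c)`. -/
theorem caterpillarA_census_corner {f e₃ ex g₂ gp eob : E} (hf : ends f = s(a₁, u))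
    (he₃ : ends e₃ = s(a₃, u)) (hex : ends ex = s(u, x)) (hg₂ : ends g₂ = s(a₂, x))
    (hgp : ends gp = s(b, x)) (heob : ends eob = s(b, o))
    (hleaf1 : ∀ e, a₁ ∈ ends e → e = f) (hleaf3 : ∀ e, a₃ ∈ ends e → e = e₃)
    (hleaf2 : ∀ e, a₂ ∈ ends e → e = g₂) (hleafo : ∀ e, o ∈ ends e → e = eob)
    (hedgeb : ∀ e, b ∈ ends e → e = gp ∨ e = eob)
    (h1u : a₁ ≠ u) (h12 : a₁ ≠ a₂) (h13 : a₁ ≠ a₃) (h1b : a₁ ≠ b) (h1o : a₁ ≠ o) (h2u : a₂ ≠ u)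
    (h2x : a₂ ≠ x) (h23 : a₂ ≠ a₃) (h2b : a₂ ≠ b) (h2o : a₂ ≠ o) (h3u : a₃ ≠ u) (h3b : a₃ ≠ b)
    (h3o : a₃ ≠ o) (hbu : b ≠ u) (hbx : b ≠ x) (hob : o ≠ b) (hou : o ≠ u) (hox : o ≠ x)
    (hux : u ≠ x)
    (hfe₃ : f ≠ e₃) (hfex : f ≠ ex) (hfg₂ : f ≠ g₂) (hfgp : f ≠ gp) (he₃ex : e₃ ≠ ex)
    (he₃g₂ : e₃ ≠ g₂) (he₃gp : e₃ ≠ gp) (hexg₂ : ex ≠ g₂) (hexgp : ex ≠ gp) (hg₂gp : g₂ ≠ gp)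
    (F : Finset E) (hF : ∀ e ∈ F, e = f ∨ e = e₃ ∨ e = ex ∨ e = g₂ ∨ e = gp ∨ e = eob)
    (hfF : f ∈ F) (he₃F : e₃ ∈ F) (hexF : ex ∈ F) (hg₂F : g₂ ∈ F) (hgpF : gp ∈ F)
    (heobF : eob ∈ F) (z : Config E) (hz : ∀ e, e ∉ F → z e = false)
    (τ : E → ℕ) (hτ3 : τ e₃ = 1) (hτ2 : τ g₂ = 1) (hτp : τ gp = 1) (hτob : 1 ≤ τ eob)
    (hτx : τ ex = 1 ∨ τ ex = 2) :
    typedCount F z (Function.update τ f 1)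
          (K3 ends o a₁ a₂ a₃ b : Config E → Config E → Config E → R) =
        typedCount F z (Function.update τ f 3) (K3 ends o a₁ a₂ a₃ b) ∧
      typedCount F z (Function.update τ f 2)
          (K3 ends o a₁ a₂ a₃ b : Config E → Config E → Config E → R) =
        2 * typedCount F z (Function.update τ f 3) (K3 ends o a₁ a₂ a₃ b) ∧
      typedCount F z (Function.update τ f 3)
          (K3 ends o a₁ a₂ a₃ b : Config E → Config E → Config E → R) =
        (Nat.choose 2 (τ eob - 1) : R) * (2 * (Nat.choose 2 (τ ex) : R)) := by
  -- the five typed edges are not `eob`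
  have hne_eob : ∀ {e : E} {p q : V}, ends e = s(p, q) → p ≠ b → p ≠ o → e ≠ eob := by
    intro e p q he hpb hpo h
    subst h
    rw [heob, Sym2.eq_iff] at he
    rcases he with ⟨h1, -⟩ | ⟨-, h1⟩
    · exact hpb h1.symm
    · exact hpo h1.symm
  have hfeob : f ≠ eob := hne_eob hf h1b h1o
  have he₃eob : e₃ ≠ eob := hne_eob he₃ h3b h3o
  have hexeob : ex ≠ eob := hne_eob hex hbu.symm hou.symm
  have hg₂eob : g₂ ≠ eob := hne_eob hg₂ h2b h2o
  have hgpeob : gp ≠ eob := by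
    intro h
    rw [h, heob, Sym2.eq_iff] at hgp
    rcases hgp with ⟨-, h1⟩ | ⟨h1, -⟩
    · exact hox h1
    · exact hbx h1
  -- the contraction of `eob` into `b`
  set W : Finset V := {b, o} with hW
  have hmem : ∀ v : V, v ∈ W ↔ v = b ∨ v = o := fun v => by
    rw [hW, Finset.mem_insert, Finset.mem_singleton]
  have cmb : contractMap W b b = b := contractMap_of_mem ((hmem b).2 (Or.inl rfl))
  have cmo : contractMap W b o = b := contractMap_of_mem ((hmem o).2 (Or.inr rfl))
  have cmfix : ∀ v : V, v ≠ b → v ≠ o → contractMap W b v = v := fun v hv1 hv2 =>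
    contractMap_of_notMem (fun h => by rcases (hmem v).1 h with h | h <;> contradiction)
  have cm1 := cmfix a₁ h1b h1o
  have cm2 := cmfix a₂ h2b h2o
  have cm3 := cmfix a₃ h3b h3o
  have cmu := cmfix u hbu.symm hou.symm
  have cmx := cmfix x hbx.symm hox.symm
  set ends' := contractEnds ends W b with hends'
  have hloop : ends' eob = s(b, b) := by
    rw [hends', contractEnds_apply, heob, Sym2.map_mk, cmb, cmo]
  have heobF' : eob ∉ F.erase eob := fun h => (Finset.mem_erase.1 h).1 rfl
  -- the support after the contraction: the five typed edges
  set S : Finset E := F.erase eob with hS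
  have hfS : f ∈ S := Finset.mem_erase.2 ⟨hfeob, hfF⟩
  have he₃S : e₃ ∈ S := Finset.mem_erase.2 ⟨he₃eob, he₃F⟩
  have hexS : ex ∈ S := Finset.mem_erase.2 ⟨hexeob, hexF⟩
  have hg₂S : g₂ ∈ S := Finset.mem_erase.2 ⟨hg₂eob, hg₂F⟩
  have hgpS : gp ∈ S := Finset.mem_erase.2 ⟨hgpeob, hgpF⟩
  have hzS : ∀ e, e ∉ S → Function.update z eob false e = false := by
    intro e he
    by_cases h : e = eob
    · rw [h, Function.update_self]
    · rw [Function.update_of_ne h]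
      exact hz e (fun hF' => he (Finset.mem_erase.2 ⟨h, hF'⟩))
  -- the reduction of each typed base to the restricted instance with `o = b`
  have red : ∀ k : ℕ, typedCount F z (Function.update τ f k)
      (K3 ends o a₁ a₂ a₃ b : Config E → Config E → Config E → R) =
      (Nat.choose 2 (τ eob - 1) : R) *
        typedCount (rF S (F.erase eob)) (rConfig S (Function.update z eob false))
          (Function.update (rτ S τ) ⟨f, hfS⟩ k)
          (K3 (rEnds S ends') b a₁ a₂ a₃ b : Config S → Config S → Config S → R) := by
    intro k
    have hk : 1 ≤ Function.update τ f k eob := by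
      rw [Function.update_of_ne hfeob.symm]; exact hτob
    have heob' : ends eob = s(o, b) := by rw [heob, Sym2.eq_swap]
    rw [typedCount_pendant_o ends o a₁ a₂ a₃ b heob' hleafo hob h1o.symm h2o.symm h3o.symm hob F
      heobF z _ hk, Function.update_of_ne hfeob.symm]
    congr 1
    rw [typedCount_type_three F eob heobF z _ (Function.update_self eob 3 _),
      typedCount_contract_open ends o a₁ a₂ a₃ b heob (F.erase eob) heobF'
        (Function.update z eob true) (Function.update_self eob true z),
      cmo, cm1, cm2, cm3, cmb, ← hends',
      typedCount_pinned_loop ends' b a₁ a₂ a₃ b hloop (F.erase eob) heobF' _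
        (Function.update_self eob true z), Function.update_idem,
      typedCount_restrict S ends' b a₁ a₂ a₃ b (Finset.Subset.refl _) hzS]
    refine typedCount_congr_τ _ _ (fun e he => ?_) _
    obtain ⟨hne, -⟩ := Finset.mem_erase.1 (mem_rF.1 he)
    show Function.update (Function.update τ f k) eob 3 e.1 = _
    rw [Function.update_of_ne hne]
    by_cases hef : e = ⟨f, hfS⟩
    · rw [hef, Function.update_self, Function.update_self]
    · have hef' : e.1 ≠ f := fun h => hef (Subtype.ext h)
      rw [Function.update_of_ne hef, Function.update_of_ne hef']
      rfl
  -- the restricted instance is the caterpillar with the pair at `b`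
  have hf' : rEnds S ends' ⟨f, hfS⟩ = s(a₁, u) := by
    show ends' f = _
    rw [hends', contractEnds_apply, hf, Sym2.map_mk, cm1, cmu]
  have he₃' : rEnds S ends' ⟨e₃, he₃S⟩ = s(a₃, u) := by
    show ends' e₃ = _
    rw [hends', contractEnds_apply, he₃, Sym2.map_mk, cm3, cmu]
  have hex' : rEnds S ends' ⟨ex, hexS⟩ = s(u, x) := by
    show ends' ex = _
    rw [hends', contractEnds_apply, hex, Sym2.map_mk, cmu, cmx]
  have hg₂' : rEnds S ends' ⟨g₂, hg₂S⟩ = s(a₂, x) := by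
    show ends' g₂ = _
    rw [hends', contractEnds_apply, hg₂, Sym2.map_mk, cm2, cmx]
  have hgp' : rEnds S ends' ⟨gp, hgpS⟩ = s(b, x) := by
    show ends' gp = _
    rw [hends', contractEnds_apply, hgp, Sym2.map_mk, cmb, cmx]
  -- a mark other than the pair is met by the contracted ends exactly where it was
  have hmark : ∀ (m : V), m ≠ b → ∀ e : S, m ∈ rEnds S ends' e → m ∈ ends e.1 := by
    intro m hmb e he
    change m ∈ ends' e.1 at he
    rw [hends', contractEnds_apply, Sym2.mem_map] at he
    obtain ⟨v, hv, hvm⟩ := he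
    by_cases hvW : v ∈ W
    · rw [contractMap_of_mem hvW] at hvm
      exact absurd hvm hmb.symm
    · rw [contractMap_of_notMem hvW] at hvm
      rw [hvm] at hv
      exact hv
  have hleaf1' : ∀ e : S, a₁ ∈ rEnds S ends' e → e = ⟨f, hfS⟩ :=
    fun e he => Subtype.ext (hleaf1 e.1 (hmark a₁ h1b e he))
  have hleaf3' : ∀ e : S, a₃ ∈ rEnds S ends' e → e = ⟨e₃, he₃S⟩ :=
    fun e he => Subtype.ext (hleaf3 e.1 (hmark a₃ h3b e he))
  have hleaf2' : ∀ e : S, a₂ ∈ rEnds S ends' e → e = ⟨g₂, hg₂S⟩ :=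
    fun e he => Subtype.ext (hleaf2 e.1 (hmark a₂ h2b e he))
  have hleafw' : ∀ e : S, b ∈ rEnds S ends' e → e = ⟨gp, hgpS⟩ := by
    intro e he
    change b ∈ ends' e.1 at he
    rw [hends', contractEnds_apply, Sym2.mem_map] at he
    obtain ⟨v, hv, hvb⟩ := he
    have hne : e.1 ≠ eob := (Finset.mem_erase.1 e.2).1
    refine Subtype.ext ?_
    by_cases hvW : v ∈ W
    · rcases (hmem v).1 hvW with rfl | rfl
      · rcases hedgeb e.1 hv with h | h
        · exact h
        · exact absurd h hne
      · exact absurd (hleafo e.1 hv) hne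
    · rw [contractMap_of_notMem hvW] at hvb
      exact absurd ((hmem v).2 (Or.inl hvb)) hvW
  have hF' : ∀ e ∈ rF S (F.erase eob), e = ⟨f, hfS⟩ ∨ e = ⟨e₃, he₃S⟩ ∨ e = ⟨ex, hexS⟩ ∨
      e = ⟨g₂, hg₂S⟩ ∨ e = ⟨gp, hgpS⟩ := by
    intro e he
    obtain ⟨hne, heF⟩ := Finset.mem_erase.1 (mem_rF.1 he)
    rcases hF e.1 heF with h | h | h | h | h | h
    · exact Or.inl (Subtype.ext h)
    · exact Or.inr (Or.inl (Subtype.ext h))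
    · exact Or.inr (Or.inr (Or.inl (Subtype.ext h)))
    · exact Or.inr (Or.inr (Or.inr (Or.inl (Subtype.ext h))))
    · exact Or.inr (Or.inr (Or.inr (Or.inr (Subtype.ext h))))
    · exact absurd h hne
  have hclu' : ∀ e : S, e ≠ ⟨f, hfS⟩ → e ≠ ⟨e₃, he₃S⟩ → e ≠ ⟨ex, hexS⟩ →
      u ∈ rEnds S ends' e → rConfig S (Function.update z eob false) e = false := by
    intro e hef hee₃ heex hue
    exfalso
    have hu : u ∈ ends e.1 := hmark u hbu.symm e hue
    obtain ⟨hne, heF⟩ := Finset.mem_erase.1 e.2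
    rcases hF e.1 heF with h | h | h | h | h | h
    · exact hef (Subtype.ext h)
    · exact hee₃ (Subtype.ext h)
    · exact heex (Subtype.ext h)
    · rw [h, hg₂, Sym2.mem_iff] at hu
      rcases hu with h' | h'
      · exact h2u h'.symm
      · exact hux h'
    · rw [h, hgp, Sym2.mem_iff] at hu
      rcases hu with h' | h'
      · exact hbu h'.symm
      · exact hux h'
    · exact hne h
  obtain ⟨c1, c2, c3⟩ := caterpillarA_corner (R := R) (rEnds S ends') a₁ a₂ a₃ u x b hf' he₃' hex'
    hg₂' hgp' hleaf1' hleaf3' hleaf2' hleafw' h1u h12 h13 h1b h2u h2x h23 h2b h3u h3b hbu hbx hux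
    (fun h => hfe₃ (congrArg Subtype.val h)) (fun h => hfex (congrArg Subtype.val h))
    (fun h => hfg₂ (congrArg Subtype.val h)) (fun h => hfgp (congrArg Subtype.val h))
    (fun h => he₃ex (congrArg Subtype.val h)) (fun h => he₃g₂ (congrArg Subtype.val h))
    (fun h => he₃gp (congrArg Subtype.val h)) (fun h => hexg₂ (congrArg Subtype.val h))
    (fun h => hexgp (congrArg Subtype.val h)) (fun h => hg₂gp (congrArg Subtype.val h))
    (rF S (F.erase eob)) hF' (mem_rF.2 hfS) (mem_rF.2 he₃S) (mem_rF.2 hexS) (mem_rF.2 hg₂S)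
    (mem_rF.2 hgpS) (rConfig S (Function.update z eob false)) hclu' (rτ S τ) hτ3 hτ2 hτp hτx
  refine ⟨?_, ?_, ?_⟩
  · rw [red 1, red 3, c1]
  · rw [red 2, red 3, c2]
    ring
  · rw [red 3, c3]
    rfl

end Census

end TypedRed

end CovForm

end Summit.Ventures.PercRepro2
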